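import Summits.ResolutionOfSingularities.ResolutionOfSingularities.Theorems.FrobeniusLadderFInjectiveMacaulayficationX2Cubic4FloorFullCert
import Summits.ResolutionOfSingularities.ResolutionOfSingularities.Theorems.FrobeniusLadderFInjectiveMacaulayficationX2Cubic4FloorTwoGlue
import Summits.ResolutionOfSingularities.ResolutionOfSingularities.Theorems.FrobeniusLadderFInjectiveMacaulayficationTCaFloorOneRow
import HarnessLib

/-!
# (RR-I2) THE POINT FLOOR OF `Y = {x² + y³ + u³ + t³ + s³}` IS FULL AT EVERY STALK FOR EVERY PRIME `p ∉ {2, 3}` — the T″ row is LEGAL AND NON-VACUOUS; by-product: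
# the F-half «floor-1-full» germ row `FInjectivizationGermAt p v` in all characteristics `≥ 5`
# (crux `FInjectiveMacaulayfication` stmt-ResolutionOfSingularities-15315, chain w45a; assembly (L-B) over the `p`-uniform derivative certificate `X2Cubic4FloorFullCert`, res-L1-w45a-stub-1's
# engines `GermOfGlobalBlowup.hypersurfacePointBlowup_fullCl` / `fInjectivizationGermAt_origin_of_hypersurfacePointBlowup`, and g10's input side; seat res-L1-w45a-lead-1 g11)

[OURS · L1 W4.5a] Support file (`--supports stmt-ResolutionOfSingularities-15315 --as helper`); def-free; UNCONDITIONAL; no named fact; NOT a statement of any manuscript.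
AI-written (AI review is weaker than expert review).

`Y = Spec k[X₀..X₄]/(f)`, `f = X₄² + X₀³ + X₁³ + X₂³ + X₃³`, `2 ≠ 0`, `3 ≠ 0` in `k` (every characteristic `p ≥ 5`), `v` the vertex, `𝔪 = (x̄ⱼ)`, `Y₁ = Bl_𝔪 Y = affineBlowup 𝔪`.
* §1 `clause_every_chart` — the `hpts` input of the engines for all five charts of `X2Cubic4PointFloor.theta` (singular charts by `X2Cubic4FloorFullCert.clause_chart` at
  `(a,b,c,d) = (0,1,2,3), (1,0,2,3), (2,0,1,3), (3,0,1,2)`; the `x`-chart vacuously, `X2Cubic4FloorFullCert.chartFour_X_not_mem`).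
* §2 ★★ `affineBlowup_vertex_fullCl` — **`∀ y : Bl_𝔪 Y, FullCl p (𝒪_{Y₁,y})`** for every prime `p` with `2, 3 ≠ 0` in `k`; ★★ `pointFloor_x2cubic4_full` — EVERY blowing up `S′` of
  `Spec 𝒪_{Y,v}` along `𝔪̃·𝒪_{Y,v}` is FULL at every stalk; ★★ `pointFloor_x2cubic4_legal_full` — together with g10's ✓ `X2Cubic4PointFloor.pointFloor_x2cubic4_input_legal`: such an `S′`
  satisfies ALL FOUR hypotheses of the inner block of T″ (`I ≠ ⊥`, admissible, regular off the closed fibre, FULL at every stalk) ⇒ the instance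
  ✓ `X2Cubic4FloorTwoGlue.tStepInstanceAt_x2cubic4_origin` is NON-VACUOUS: its conclusion (a fibre-supported `𝓚 ≠ ⊥` all of whose blowings up are regular) is ASSERTED of the
  actual point floor, for all `p ≥ 5`.
* §3 ★★ `x2cubic4_fInjectivizationGermAt` — the F-half's ∃-conclusion `GermForm.FInjectivizationGermAt p v` at the vertex, witnessed by the point floor itself (a «floor-1-full
  row» in the sense of R21.17 (3)(a), like TCa at `p = 2`), for EVERY prime `p ∉ {2,3}` and every field of characteristic `p` — the first F-half germ row valid in all large
  characteristics.
REMAINING CAVEAT (vertex): `FullCl p (𝒪_{Y,v})` itself — the T″ stub's OUTER hypothesis «`y` FULL» — is not proved here for generic `p` (it needs the multinomial certificate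
`∂^α f^{p−1} = unit`, `α = (2i, 3j, 3k, 3l, 3m)`); the instance and the legality above do not use it. One bed; evidence for nothing beyond itself; both research stubs OPEN.
[folklore assembly; cite: Fedder1983, Prop. 1.7, Thm. 1.12; GortzWedhorn2020, Prop. 13.91 (2), (13.19); StacksProject, Tag 0804; Temkin2008, §2.1]
-/

-- single-problem summit: the doubled namespace component is forced
set_option linter.dupNamespace false

noncomputable section

namespace Summit.ResolutionOfSingularities.ResolutionOfSingularities.Theorems.FInjectiveMacaulayfication.X2Cubic4FloorFull

open CategoryTheory CategoryTheory.Limits AlgebraicGeometry TopologicalSpace IsLocalRing MvPolynomial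
open Literature.AlgebraicGeometry.Resolution
open Summit.ResolutionOfSingularities.ResolutionOfSingularities.Theorems.FInjectiveMacaulayfication
open SliceableCentre GermOfGlobalBlowup GermForm

variable (k : Type) [Field k]

/-! ## §1 The clause on every chart at every closed point of the exceptional divisor -/

/-- ★ **`hpts` for all five charts of `Bl_𝔪 Y`** (`3 ≠ 0` in `k`, any prime `p = char k`): at every maximal ideal `Q ∋ x̄ᵢ` of the chart ring `k[X]/(gᵢ)` the FULL clause holds —
by the `p`-uniform derivative certificate on the four singular charts, vacuously on the `x`-chart. [OURS · assembly] -/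
theorem clause_every_chart (p : ℕ) [Fact p.Prime] [CharP k p] (h3 : (3 : k) ≠ 0) (G : Fin 5 → MvPolynomial (Fin 5) k)
    (hG : G = ![X 4 ^ 2 + X 0 + X 0 * X 1 ^ 3 + X 0 * X 2 ^ 3 + X 0 * X 3 ^ 3,
        X 4 ^ 2 + X 1 * X 0 ^ 3 + X 1 + X 1 * X 2 ^ 3 + X 1 * X 3 ^ 3,
        X 4 ^ 2 + X 2 * X 0 ^ 3 + X 2 * X 1 ^ 3 + X 2 + X 2 * X 3 ^ 3,
        X 4 ^ 2 + X 3 * X 0 ^ 3 + X 3 * X 1 ^ 3 + X 3 * X 2 ^ 3 + X 3,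
        1 + X 4 * X 0 ^ 3 + X 4 * X 1 ^ 3 + X 4 * X 2 ^ 3 + X 4 * X 3 ^ 3]) :
    ∀ (i : Fin 5) (Q : Ideal (MvPolynomial (Fin 5) k ⧸ Ideal.span {G i})) [Q.IsMaximal],
      Ideal.Quotient.mk _ (X i) ∈ Q →
      ∀ d : ℕ, ringKrullDim (Localization.AtPrime Q) = d → ∀ s : Fin d → Localization.AtPrime Q,
        (Ideal.span (Set.range s)).radical.IsMaximal →
          RingTheory.Sequence.IsWeaklyRegular (Localization.AtPrime Q) (List.ofFn s) ∧
          ∀ y : Localization.AtPrime Q, (∃ e : ℕ, y ^ p ^ e ∈ Ideal.span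
            ((fun z : Localization.AtPrime Q => z ^ p ^ e) ''
              (Ideal.span (Set.range s) : Set (Localization.AtPrime Q)))) → y ∈ Ideal.span (Set.range s) := by
  intro i Q hQ hXi
  fin_cases i
  · have hGi : G 0 = X 4 ^ 2 + X 0 + X 0 * X 1 ^ 3 + X 0 * X 2 ^ 3 + X 0 * X 3 ^ 3 := by rw [hG]; rfl
    exact @X2Cubic4FloorFullCert.clause_chart k _ p _ _ h3 0 1 2 3 (by decide) (by decide) (by decide) (by decide) (by decide) (by decide) (by decide) (G 0)
      (by rw [hGi]; ring) Q hQ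
  · have hGi : G 1 = X 4 ^ 2 + X 1 * X 0 ^ 3 + X 1 + X 1 * X 2 ^ 3 + X 1 * X 3 ^ 3 := by rw [hG]; rfl
    exact @X2Cubic4FloorFullCert.clause_chart k _ p _ _ h3 1 0 2 3 (by decide) (by decide) (by decide) (by decide) (by decide) (by decide) (by decide) (G 1)
      (by rw [hGi]; ring) Q hQ
  · have hGi : G 2 = X 4 ^ 2 + X 2 * X 0 ^ 3 + X 2 * X 1 ^ 3 + X 2 + X 2 * X 3 ^ 3 := by rw [hG]; rfl
    exact @X2Cubic4FloorFullCert.clause_chart k _ p _ _ h3 2 0 1 3 (by decide) (by decide) (by decide) (by decide) (by decide) (by decide) (by decide) (G 2)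
      (by rw [hGi]; ring) Q hQ
  · have hGi : G 3 = X 4 ^ 2 + X 3 * X 0 ^ 3 + X 3 * X 1 ^ 3 + X 3 * X 2 ^ 3 + X 3 := by rw [hG]; rfl
    exact @X2Cubic4FloorFullCert.clause_chart k _ p _ _ h3 3 0 1 2 (by decide) (by decide) (by decide) (by decide) (by decide) (by decide) (by decide) (G 3)
      (by rw [hGi]; ring) Q hQ
  · exfalso
    have hGi : G 4 = 1 + X 4 * X 0 ^ 3 + X 4 * X 1 ^ 3 + X 4 * X 2 ^ 3 + X 4 * X 3 ^ 3 := by rw [hG]; rfl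
    exact X2Cubic4FloorFullCert.chartFour_X_not_mem k (G 4) (X 0 ^ 3 + X 1 ^ 3 + X 2 ^ 3 + X 3 ^ 3) (by rw [hGi]; ring) Q
      (Ideal.IsMaximal.ne_top hQ) hXi

/-! ## §2 The point floor is FULL at every stalk -/

/-- ★★ **`Bl_𝔪 Y` IS FULL AT EVERY POINT** (`Y = {X₄² + X₀³ + X₁³ + X₂³ + X₃³}`, every prime `p` with `2, 3 ≠ 0` in `k`): res-L1-w45a-stub-1's engine
`GermOfGlobalBlowup.hypersurfacePointBlowup_fullCl` on g10's chart data (`theta`, `f ∉ (Xᵢ)`, `gᵢ ∉ (Xᵢ)`, `Y` regular off `v`) and §1. [OURS · assembly; cite: Fedder1983, Thm. 1.12;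
GortzWedhorn2020, Prop. 13.92] -/
theorem affineBlowup_vertex_fullCl (p : ℕ) [Fact p.Prime] [CharP k p] (h2 : (2 : k) ≠ 0) (h3 : (3 : k) ≠ 0) (f : MvPolynomial (Fin 5) k)
    (hf : f = X 4 ^ 2 + X 0 ^ 3 + X 1 ^ 3 + X 2 ^ 3 + X 3 ^ 3) :
    ∀ y : ↥(affineBlowup (Ideal.span (Set.range fun j : Fin 5 => Ideal.Quotient.mk (Ideal.span {f}) (X j)))),
      FullCl p ((affineBlowup (Ideal.span (Set.range fun j : Fin 5 => Ideal.Quotient.mk (Ideal.span {f}) (X j)))).presheaf.stalk y) := by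
  have hprime := X2Cubic4Specimen.prime_f k h3 f hf
  haveI hfprime : (Ideal.span {f}).IsPrime := (Ideal.span_singleton_prime hprime.ne_zero).mpr hprime
  exact hypersurfacePointBlowup_fullCl p k 5 (by norm_num) f _ 2 hfprime (fun i => by have h := X2Cubic4PointFloor.theta k f hf i; dsimp only at h; exact h)
    (X2Cubic4Specimen.f_not_mem_span_X k f hf) (X2Cubic4PointFloor.g_not_mem_span_X k)
    (fun P _ hP => X2Cubic4Specimen.regular_off_vertex k h2 h3 f hf P hP) (clause_every_chart k p h3 _ rfl)

/-- ★★ **EVERY blowing up `S′` of `Spec 𝒪_{Y,v}` along `𝔪̃·𝒪_{Y,v}` is FULL at every stalk** (it is the flat pull-back of `Bl_𝔪 Y` up to isomorphism, whose stalks are stalks of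
`Bl_𝔪 Y`; transport verbatim as in `TCaFloorOneRow.pointFloor_tca_full`). [folklore transport; cite: GortzWedhorn2020, Prop. 13.91; StacksProject, Tag 0804] -/
theorem pointFloor_x2cubic4_full (p : ℕ) [Fact p.Prime] [CharP k p] (h2 : (2 : k) ≠ 0) (h3 : (3 : k) ≠ 0) (f : MvPolynomial (Fin 5) k)
    (hf : f = X 4 ^ 2 + X 0 ^ 3 + X 1 ^ 3 + X 2 ^ 3 + X 3 ^ 3)
    (v : Spec (.of (MvPolynomial (Fin 5) k ⧸ Ideal.span {f})))
    (S' : Scheme.{0}) (g : S' ⟶ Spec ((Spec (.of (MvPolynomial (Fin 5) k ⧸ Ideal.span {f}))).presheaf.stalk v))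
    (hg : IsBlowup g ((affineBlowup.idealSheaf (Ideal.span (Set.range (fun j : Fin 5 => Ideal.Quotient.mk (Ideal.span {f}) (X j))))).comap
      ((Spec (.of (MvPolynomial (Fin 5) k ⧸ Ideal.span {f}))).fromSpecStalk v))) :
    ∀ s : S', FullCl p (S'.presheaf.stalk s) := by
  haveI : Flat ((Spec (.of (MvPolynomial (Fin 5) k ⧸ Ideal.span {f}))).fromSpecStalk v) := flat_fromSpecStalk _ v
  have hP := (affineBlowup.isBlowup (Ideal.span (Set.range (fun j : Fin 5 => Ideal.Quotient.mk (Ideal.span {f}) (X j))))).pullback_snd_of_flat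
    ((Spec (.of (MvPolynomial (Fin 5) k ⧸ Ideal.span {f}))).fromSpecStalk v)
  obtain ⟨e, -, -⟩ := hg.unique hP
  intro s
  haveI := isIso_stalkMap_of_flat_of_isPreimmersion e.hom s
  refine FTemkinClosedPoints.fullCl_of_isIso_stalkMap' p e.hom s ?_
  haveI := isIso_stalkMap_pullback_fst_fromSpecStalk
    (affineBlowup.π (Ideal.span (Set.range (fun j : Fin 5 => Ideal.Quotient.mk (Ideal.span {f}) (X j))))) v (e.hom s)
  exact FTemkinClosedPoints.fullCl_of_isIso_stalkMap' p
    (pullback.fst (affineBlowup.π (Ideal.span (Set.range (fun j : Fin 5 => Ideal.Quotient.mk (Ideal.span {f}) (X j))))) ((Spec (.of (MvPolynomial (Fin 5) k ⧸ Ideal.span {f}))).fromSpecStalk v))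
    (e.hom s) (affineBlowup_vertex_fullCl k p h2 h3 f hf _)

/-- ★★ **THE RR-I2 T″ ROW IS LEGAL AND NON-VACUOUS** (every prime `p` with `2, 3 ≠ 0` in `k`): for EVERY blowing up `g : S′ → Spec 𝒪_{Y,v}` along `I = 𝔪̃·𝒪_{Y,v}` ALL FOUR hypotheses
of the inner block of T″ (`TStepGerm.TStepInstanceAt p v I`) hold — `I ≠ ⊥`, `Supp I ⊆ (Reg)ᶜ`, `S′` regular off the closed fibre (g10 ✓ `X2Cubic4PointFloor.pointFloor_x2cubic4_input_legal`),
and `S′` FULL at every stalk (§2) — so ✓ `X2Cubic4FloorTwoGlue.tStepInstanceAt_x2cubic4_origin` ASSERTS its conclusion of the actual point floor. [OURS · assembly] -/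
theorem pointFloor_x2cubic4_legal_full (p : ℕ) [Fact p.Prime] [CharP k p] (h2 : (2 : k) ≠ 0) (h3 : (3 : k) ≠ 0) (f : MvPolynomial (Fin 5) k)
    (hf : f = X 4 ^ 2 + X 0 ^ 3 + X 1 ^ 3 + X 2 ^ 3 + X 3 ^ 3)
    (v : Spec (.of (MvPolynomial (Fin 5) k ⧸ Ideal.span {f})))
    (hv : v.asIdeal = Ideal.span (Set.range (fun j : Fin 5 => Ideal.Quotient.mk (Ideal.span {f}) (X j))))
    (S' : Scheme.{0}) (g : S' ⟶ Spec ((Spec (.of (MvPolynomial (Fin 5) k ⧸ Ideal.span {f}))).presheaf.stalk v))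
    (hg : IsBlowup g ((affineBlowup.idealSheaf (Ideal.span (Set.range (fun j : Fin 5 => Ideal.Quotient.mk (Ideal.span {f}) (X j))))).comap
      ((Spec (.of (MvPolynomial (Fin 5) k ⧸ Ideal.span {f}))).fromSpecStalk v))) :
    ((affineBlowup.idealSheaf (Ideal.span (Set.range (fun j : Fin 5 => Ideal.Quotient.mk (Ideal.span {f}) (X j))))).comap
        ((Spec (.of (MvPolynomial (Fin 5) k ⧸ Ideal.span {f}))).fromSpecStalk v)) ≠ ⊥ ∧
    (((((affineBlowup.idealSheaf (Ideal.span (Set.range (fun j : Fin 5 => Ideal.Quotient.mk (Ideal.span {f}) (X j))))).comap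
        ((Spec (.of (MvPolynomial (Fin 5) k ⧸ Ideal.span {f}))).fromSpecStalk v))).support :
          Set (Spec ((Spec (.of (MvPolynomial (Fin 5) k ⧸ Ideal.span {f}))).presheaf.stalk v))) ⊆
        (Scheme.regularLocus (Spec ((Spec (.of (MvPolynomial (Fin 5) k ⧸ Ideal.span {f}))).presheaf.stalk v)))ᶜ) ∧
    (∀ s : S', g.base s ≠ closedPoint ((Spec (.of (MvPolynomial (Fin 5) k ⧸ Ideal.span {f}))).presheaf.stalk v) → s ∈ Scheme.regularLocus S') ∧
    (∀ s : S', FullCl p (S'.presheaf.stalk s)) := by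
  obtain ⟨h1, h2', h3', -⟩ := X2Cubic4PointFloor.pointFloor_x2cubic4_input_legal k h2 h3 f hf v hv S' g hg
  exact ⟨h1, h2', h3', pointFloor_x2cubic4_full k p h2 h3 f hf v S' g hg⟩

/-! ## §3 By-product: the F-half's germ row at the vertex, all characteristics `≥ 5` -/

/-- ★★ **The F-half's ∃-conclusion at the germ of `Y = {x² + y³ + u³ + t³ + s³}` at its vertex, witnessed by the point floor itself**: `FInjectivizationGermAt p v` for every
prime `p` with `2, 3 ≠ 0` in `k` — a «floor-1-full row» (legal point floor that is already FULL), the first valid in all characteristics `≥ 5`. [OURS · certificate instance] -/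
theorem x2cubic4_fInjectivizationGermAt (p : ℕ) [Fact p.Prime] [CharP k p] (h2 : (2 : k) ≠ 0) (h3 : (3 : k) ≠ 0) (f : MvPolynomial (Fin 5) k)
    (hf : f = X 4 ^ 2 + X 0 ^ 3 + X 1 ^ 3 + X 2 ^ 3 + X 3 ^ 3)
    (v : Spec (.of (MvPolynomial (Fin 5) k ⧸ Ideal.span {f})))
    (hv : v.asIdeal = Ideal.span (Set.range fun j : Fin 5 => Ideal.Quotient.mk (Ideal.span {f}) (X j))) :
    FInjectivizationGermAt p v := by
  have hprime := X2Cubic4Specimen.prime_f k h3 f hf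
  haveI hfprime : (Ideal.span {f}).IsPrime := (Ideal.span_singleton_prime hprime.ne_zero).mpr hprime
  exact fInjectivizationGermAt_origin_of_hypersurfacePointBlowup p k 5 (by norm_num) f _ 2 hfprime
    (fun i => by have h := X2Cubic4PointFloor.theta k f hf i; dsimp only at h; exact h)
    (X2Cubic4Specimen.f_not_mem_span_X k f hf) (X2Cubic4PointFloor.g_not_mem_span_X k)
    (fun P _ hP => X2Cubic4Specimen.regular_off_vertex k h2 h3 f hf P hP) (clause_every_chart k p h3 _ rfl) v hv

/-- The same for every prime `p ∉ {2, 3}` and every field of characteristic `p`. [OURS · corollary] -/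
theorem x2cubic4_fInjectivizationGermAt_charP (p : ℕ) [Fact p.Prime] [CharP k p] (hp2 : p ≠ 2) (hp3 : p ≠ 3) (f : MvPolynomial (Fin 5) k)
    (hf : f = X 4 ^ 2 + X 0 ^ 3 + X 1 ^ 3 + X 2 ^ 3 + X 3 ^ 3)
    (v : Spec (.of (MvPolynomial (Fin 5) k ⧸ Ideal.span {f})))
    (hv : v.asIdeal = Ideal.span (Set.range fun j : Fin 5 => Ideal.Quotient.mk (Ideal.span {f}) (X j))) :
    FInjectivizationGermAt p v :=
  x2cubic4_fInjectivizationGermAt k p (X2Cubic4Specimen.two_three_ne_zero k p hp2 hp3).1 (X2Cubic4Specimen.two_three_ne_zero k p hp2 hp3).2 f hf v hv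

end Summit.ResolutionOfSingularities.ResolutionOfSingularities.Theorems.FInjectiveMacaulayfication.X2Cubic4FloorFull

end
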